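import Mathlib.Analysis.Calculus.ParametricIntervalIntegral
import Mathlib.Analysis.Calculus.IteratedDeriv.Lemmas
import Mathlib.Analysis.SpecialFunctions.Integrals.Basic
import Literature.Analysis.Calculus.HadamardLemma
import HarnessLib

/-!
# Derivatives of the averages `t ↦ ∫₀¹ vᵐ g(tv) dv`

For `g : ℝ → ℝ` of class `C¹` and `m : ℕ`, the function `t ↦ ∫₀¹ vᵐ g(tv) dv` (a weighted average
of `g` over `[0, t]`; for `t ≠ 0` it equals `t^{-(m+1)} ∫₀ᵗ uᵐ g(u) du`) is differentiable with

  `d/dt ∫₀¹ vᵐ g(tv) dv = ∫₀¹ v^{m+1} g'(tv) dv`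

(`hasDerivAt_integral_pow_mul_comp_mul`: differentiation under the integral sign, the `v`-integrand
`v^{m+1} g'(tv)` being bounded near any `t₀` by the maximum of `|g'|` on a compact interval), hence
for smooth `g` the iterated derivatives are `∫₀¹ v^{m+n} g⁽ⁿ⁾(tv) dv`
(`iteratedDeriv_integral_pow_mul_comp_mul`) and obey `|·| ≤ sup |g⁽ⁿ⁾|`-type bounds
(`norm_integral_pow_mul_comp_mul_le`); `t ↦ ∫₀¹ vᵐ g(tv) dv` is `Cⁿ` when `g` is
(`contDiff_integral_pow_mul_comp_mul`, from `Literature.Analysis.Calculus.contDiff_intervalIntegral`),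
and `t ∫₀¹ vᵐ g(tv) dv = t^{-m} ∫₀ᵗ uᵐ g(u) du` for `t ≠ 0` (`mul_integral_pow_mul_comp_mul`).
These are the calculus facts behind the regularity of solutions of the radial ODEs of
Gallay–Wayne 2006, §3 (written as fixed points of Volterra-type operators). Everything is
proved; no definitions. [folklore]
-/

noncomputable section

open Set Filter MeasureTheory intervalIntegral Metric
open scoped Topology ContDiff

namespace Literature.Analysis.Calculus

/-- **Differentiation under the integral sign for `∫₀¹ vᵐ g(tv) dv`** (`g ∈ C¹`):
the derivative at `t₀` is `∫₀¹ v^{m+1} g'(t₀v) dv`. [folklore] -/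
theorem hasDerivAt_integral_pow_mul_comp_mul {g : ℝ → ℝ} (hg : ContDiff ℝ 1 g) (m : ℕ) (t₀ : ℝ) :
    HasDerivAt (fun t => ∫ v in (0 : ℝ)..1, v ^ m * g (t * v))
      (∫ v in (0 : ℝ)..1, v ^ (m + 1) * deriv g (t₀ * v)) t₀ := by
  have hgc : Continuous g := hg.continuous
  have hg'c : Continuous (deriv g) := hg.continuous_deriv le_rfl
  have hgd : ∀ y, HasDerivAt g (deriv g y) y := fun y =>
    (hg.differentiable one_ne_zero y).hasDerivAt
  -- a bound for `g'` on `[-(|t₀|+1), |t₀|+1]`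
  obtain ⟨C, hC⟩ := (isCompact_Icc (a := -(|t₀| + 1)) (b := |t₀| + 1)).exists_bound_of_continuousOn
    hg'c.continuousOn
  have key := hasDerivAt_integral_of_dominated_loc_of_deriv_le (μ := volume) (a := 0) (b := 1)
    (F := fun t v => v ^ m * g (t * v)) (F' := fun t v => v ^ (m + 1) * deriv g (t * v))
    (x₀ := t₀) (bound := fun _ => |C|) (ball_mem_nhds t₀ one_pos) ?_ ?_ ?_ ?_ ?_ ?_
  · exact key.2
  · exact Eventually.of_forall fun t => (by fun_prop : Continuous fun v : ℝ =>
      v ^ m * g (t * v)).aestronglyMeasurable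
  · exact (by fun_prop : Continuous fun v : ℝ => v ^ m * g (t₀ * v)).intervalIntegrable _ _
  · exact (by fun_prop : Continuous fun v : ℝ =>
      v ^ (m + 1) * deriv g (t₀ * v)).aestronglyMeasurable
  · refine Eventually.of_forall fun v hv t ht => ?_
    have hv' : 0 ≤ v ∧ v ≤ 1 := by
      rw [uIoc_of_le zero_le_one] at hv
      exact ⟨hv.1.le, hv.2⟩
    have htv : t * v ∈ Icc (-(|t₀| + 1)) (|t₀| + 1) := by
      have ht' : |t - t₀| < 1 := by rwa [mem_ball, dist_eq_norm, Real.norm_eq_abs] at ht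
      have h1 : |t * v| ≤ |t₀| + 1 := by
        rw [abs_mul, abs_of_nonneg hv'.1]
        calc |t| * v ≤ |t| * 1 := by gcongr; exact hv'.2
          _ = |t| := mul_one _
          _ ≤ |t₀| + 1 := by
            have := abs_sub_abs_le_abs_sub t t₀
            linarith
      exact ⟨by linarith [neg_abs_le (t * v)], (le_abs_self _).trans h1⟩
    rw [norm_mul, norm_pow, Real.norm_eq_abs, abs_of_nonneg hv'.1]
    calc v ^ (m + 1) * ‖deriv g (t * v)‖ ≤ 1 * |C| := by
          gcongr
          · exact pow_le_one₀ hv'.1 hv'.2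
          · exact (hC _ htv).trans (le_abs_self C)
      _ = |C| := one_mul _
  · exact intervalIntegrable_const
  · refine Eventually.of_forall fun v _ t _ => ?_
    have h := ((hgd (t * v)).comp t ((hasDerivAt_id t).mul_const v)).const_mul (v ^ m)
    have e : v ^ m * (deriv g (t * v) * (1 * v)) = v ^ (m + 1) * deriv g (t * v) := by ring
    rw [e] at h
    exact h

/-- The derivative of `t ↦ ∫₀¹ vᵐ g(tv) dv` as an identity of functions (`g ∈ C¹`). [folklore] -/
theorem deriv_integral_pow_mul_comp_mul {g : ℝ → ℝ} (hg : ContDiff ℝ 1 g) (m : ℕ) :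
    deriv (fun t => ∫ v in (0 : ℝ)..1, v ^ m * g (t * v)) =
      fun t => ∫ v in (0 : ℝ)..1, v ^ (m + 1) * deriv g (t * v) :=
  funext fun t => (hasDerivAt_integral_pow_mul_comp_mul hg m t).deriv

/-- **Iterated derivatives of `∫₀¹ vᵐ g(tv) dv`** for smooth `g`:
`(d/dt)ⁿ ∫₀¹ vᵐ g(tv) dv = ∫₀¹ v^{m+n} g⁽ⁿ⁾(tv) dv`. [folklore] -/
theorem iteratedDeriv_integral_pow_mul_comp_mul {g : ℝ → ℝ} (hg : ContDiff ℝ ∞ g) (n m : ℕ) :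
    iteratedDeriv n (fun t => ∫ v in (0 : ℝ)..1, v ^ m * g (t * v)) =
      fun t => ∫ v in (0 : ℝ)..1, v ^ (m + n) * iteratedDeriv n g (t * v) := by
  induction n generalizing g m with
  | zero => simp
  | succ n ih =>
    rw [iteratedDeriv_succ', deriv_integral_pow_mul_comp_mul (hg.of_le (mod_cast le_top)) m,
      ih (contDiff_infty_iff_deriv.1 hg).2 (m + 1)]
    funext t
    simp only [iteratedDeriv_succ', Nat.add_assoc, Nat.add_comm 1 n]

/-- **`t ↦ ∫₀¹ vᵐ g(tv) dv` is `Cⁿ` when `g` is.** [folklore] -/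
theorem contDiff_integral_pow_mul_comp_mul {g : ℝ → ℝ} {n : ℕ∞} (hg : ContDiff ℝ n g) (m : ℕ) :
    ContDiff ℝ n (fun t => ∫ v in (0 : ℝ)..1, v ^ m * g (t * v)) :=
  contDiff_intervalIntegral (F := fun t v => v ^ m * g (t * v))
    (by exact (contDiff_snd.pow m).mul (hg.comp (contDiff_fst.mul contDiff_snd))) 0 1

/-- `t ↦ ∫₀¹ vᵐ g(tv) dv` is continuous when `g` is. [folklore] -/
theorem continuous_integral_pow_mul_comp_mul {g : ℝ → ℝ} (hg : Continuous g) (m : ℕ) :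
    Continuous (fun t => ∫ v in (0 : ℝ)..1, v ^ m * g (t * v)) :=
  continuous_parametric_intervalIntegral_of_continuous' (by fun_prop) 0 1

/-- **Bound**: if `|g(tv)| ≤ B` for all `v ∈ [0, 1]` then `|∫₀¹ vᵐ g(tv) dv| ≤ B`. [folklore] -/
theorem norm_integral_pow_mul_comp_mul_le {g : ℝ → ℝ} {t B : ℝ} (m : ℕ)
    (hB : ∀ v ∈ Icc (0 : ℝ) 1, |g (t * v)| ≤ B) :
    |∫ v in (0 : ℝ)..1, v ^ m * g (t * v)| ≤ B := by
  have h := norm_integral_le_of_norm_le_const (a := 0) (b := 1) (C := B)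
    (f := fun v => v ^ m * g (t * v)) fun v hv => ?_
  · simpa using h
  · rw [uIoc_of_le zero_le_one] at hv
    have hv' : v ∈ Icc (0 : ℝ) 1 := ⟨hv.1.le, hv.2⟩
    rw [norm_mul, norm_pow, Real.norm_eq_abs, abs_of_nonneg hv'.1, Real.norm_eq_abs]
    calc v ^ m * |g (t * v)| ≤ 1 * B :=
          mul_le_mul (pow_le_one₀ hv'.1 hv'.2) (hB v hv') (abs_nonneg _) zero_le_one
      _ = B := one_mul _

/-- **The `u`-form**: `t ∫₀¹ vᵐ g(tv) dv = (tᵐ)⁻¹ ∫₀ᵗ uᵐ g(u) du` for `t ≠ 0`. [folklore] -/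
theorem mul_integral_pow_mul_comp_mul {g : ℝ → ℝ} {t : ℝ} (ht : t ≠ 0) (m : ℕ) :
    t * ∫ v in (0 : ℝ)..1, v ^ m * g (t * v) = (t ^ m)⁻¹ * ∫ u in (0 : ℝ)..t, u ^ m * g u := by
  have h := mul_integral_comp_mul_left (a := 0) (b := 1) (c := t)
    (f := fun u => (u / t) ^ m * g u)
  simp only [mul_zero, mul_one] at h
  have hfun : (fun v => (t * v / t) ^ m * g (t * v)) = fun v => v ^ m * g (t * v) := by
    funext v
    rw [mul_div_cancel_left₀ v ht]
  rw [hfun] at h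
  rw [h, ← intervalIntegral.integral_const_mul]
  refine intervalIntegral.integral_congr fun u _ => ?_
  rw [div_pow]
  field_simp

end Literature.Analysis.Calculus
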